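import Literature.Computability.QuantumComplexity.OracleRetarget
import Literature.Computability.QuantumComplexity.KeyAveragingHadamard
import Literature.Computability.QuantumComplexity.WireConjugation
import HarnessLib

/-!
# Running an oracle circuit on a uniformly random KEYED oracle inside one circuit: the acceptance probability is the key-average

Topic `Literature/Computability/QuantumComplexity`; assembly of `OracleRetarget.lean` (re-target the oracle gates of
a circuit `gs` to the prefixed oracle, branchwise semantics = the original circuit relative to the slice `A⟨c⟩`),
`KeyAveragingHadamard.lean` (Hadamards on a register kept classical average the event probabilities over it) and the
one-register Born rule for placed operators (`WireConjugation.placeGate_mulVec_basisState_apply`). The statement is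
the circuit-level form of "choose `key` uniformly at random and run the `T`-query algorithm with the oracle `h_key`"
(Zhandry 2012, Thm. 3.1, the simulation of a random oracle by a `2T`-wise independent family; Bennett–Bernstein–
Brassard–Vazirani 1997, §4, oracle machines as subroutines):

* `sum_normSq_placeGate_emb` — the Born weight of an event read on the transported wires of `placeGate emb U |w⟩` is
  the Born weight of `U |w ∘ emb⟩` (general wire embedding; the `castLE` case is
  `WireConjugation.sum_normSq_placeGate_castLE`);
* `acceptProb_eq_sum_ite` — the acceptance probability of a circuit as a filtered Born sum of matrix entries;
* **`sum_normSq_hadamards_retarget_eq_avg_acceptProb`** — for a circuit `gs` on `n + m` wires (input `x`, `m`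
  ancillas), a big register with the original wires transported along `emb`, `P` prefix wires `p` disjoint from them,
  and `κ` KEY wires `t.trans p` among the prefix: if the big basis input `w` carries `x 0^m` on the transported wires
  and `0^κ` on the key wires, then the probability that the transported answer wire `emb 0` reads `1` after
  `(H on the key wires) ++ retarget p emb gs`, relative to the oracle `A`, equals
  `2^{-κ} Σ_key acceptProb_{A⟨c_key⟩}(gs, x)` with `c_key` the prefix content of `w` with `key` written on the key
  wires — the KEY-AVERAGE of the original acceptance probabilities relative to the sliced oracles;
* `sum_normSq_hadamards_retarget_eq_avg_event` (appended) — the same for an arbitrary event `T` read through `emb`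
  (e.g. "the query register spells `σ`"), `sum_ite_normSq_toMatrix_eq_probEvent` (the Born sum is `probEvent`).

Everything here is PROVED; no definition, no named fact.

## References

* M. Zhandry, *Secure identity-based encryption in the quantum random oracle model*, CRYPTO 2012 (arXiv:1204.0629),
  Thm. 3.1 [Zhandry2012].
* C. H. Bennett, E. Bernstein, G. Brassard, U. Vazirani, *Strengths and weaknesses of quantum computing*, SIAM J.
  Comput. 26 (1997) 1510–1523, §4 [BennettBernsteinBrassardVazirani1997].
* M. A. Nielsen, I. L. Chuang, *Quantum Computation and Quantum Information*, CUP 2010, §2.2.8 (measuring one register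
  of a composite system), §4.4 (deferred measurement) [NielsenChuang2010].
-/

noncomputable section

namespace Literature.Computability.QuantumComplexity

open Cryptography Matrix Finset

/-! ### One-register Born rule for a placed operator (general embedding) -/

/-- **Born weight of an event on the transported wires** = Born weight of the small-register operator on the
restricted input: for any wire embedding `E`, operator `U` on the small register, basis input `w` of the big register
and event `T` read through `E`. [cite: NielsenChuang2010, §2.2.8 (measurement of one register of a product state)] -/
theorem sum_normSq_placeGate_emb {b W : ℕ} (E : Fin b ↪ Fin W) (U : Matrix (QReg b) (QReg b) ℂ) (w : QReg W)
    (T : QReg b → Prop) [DecidablePred T] :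
    (∑ x : QReg W, if T (x ∘ E) then ‖(placeGate E U *ᵥ basisState w) x‖ ^ 2 else 0) =
      ∑ u : QReg b, if T u then ‖U u (w ∘ E)‖ ^ 2 else 0 := by
  classical
  have hterm : ∀ x : QReg W,
      (if T (x ∘ E) then ‖(placeGate E U *ᵥ basisState w) x‖ ^ 2 else 0) =
        if (∀ i, i ∉ Set.range E → x i = w i) then
          (if T (x ∘ E) then ‖U (x ∘ E) (w ∘ E)‖ ^ 2 else 0) else 0 := by
    intro x
    rw [placeGate_mulVec_basisState_apply]
    by_cases hc : ∀ i, i ∉ Set.range E → x i = w i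
    · rw [if_pos hc, if_pos hc]
    · rw [if_neg hc, if_neg hc]; simp
  simp_rw [hterm]
  rw [sum_ite_agree_eq_sum_extend]
  refine Finset.sum_congr rfl fun u _ => ?_
  rw [extend_comp_embedding]

/-- The acceptance probability of a circuit on a nonempty register as a filtered Born sum of matrix entries.
[cite: NielsenChuang2010, §2.2.5 (Born rule)] -/
theorem acceptProb_eq_sum_ite {G : QGateSet} {n m : ℕ} (B : Language Bool) (C : QCircuit G (n + m)) (x : QReg n)
    (h0 : 0 < n + m) :
    C.acceptProb B x = ∑ u : QReg (n + m),
      if u ⟨0, h0⟩ = true then ‖C.toMatrix B u (padInput x m)‖ ^ 2 else 0 := by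
  unfold QCircuit.acceptProb QCircuit.runOn
  refine Finset.sum_congr rfl fun u _ => ?_
  rw [dif_pos h0, mulVec_basisState]

/-! ### The key-average identity -/

/-- A basis state with `key` written on the key wires is supported on the branch of its own prefix content.
[cite: NielsenChuang2010, §4.4] -/
theorem basisState_assignKey_supported {N P κ : ℕ} (p : Fin P ↪ Fin N) (t : Fin κ ↪ Fin P) (w : QReg N)
    (key : QReg κ) :
    ∀ z : QReg N, z ∘ p ≠ assignKey (t.trans p) w key ∘ p → basisState (assignKey (t.trans p) w key) z = 0 := by
  intro z hz
  rw [basisState_apply, if_neg]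
  rintro rfl
  exact hz rfl

/-- Writing a key on key wires inside the prefix does not touch the transported wires (which are off the prefix).
[cite: NielsenChuang2010, §4.3] -/
theorem assignKey_comp_emb {N₀ N P κ : ℕ} (p : Fin P ↪ Fin N) (emb : Fin N₀ ↪ Fin N) (hdisj : ∀ a i, p a ≠ emb i)
    (t : Fin κ ↪ Fin P) (w : QReg N) (key : QReg κ) :
    assignKey (t.trans p) w key ∘ emb = w ∘ emb := by
  funext i
  simp only [Function.comp_apply]
  refine assignKey_of_not_mem_range (t.trans p) w key fun hmem => ?_
  obtain ⟨j, hj⟩ := hmem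
  exact hdisj (t j) i (by simpa [Function.Embedding.trans_apply] using hj)

/-- **The key-average identity.** Circuit `gs` on `n + m` wires (input `x` on the first `n`, `m` ancillas `0`),
transported along `emb` into a big register with `P` prefix wires `p` (disjoint from the transported wires) of which
`t.trans p` are the `κ` key wires; big basis input `w` with `w ∘ emb = x 0^m` and `0` on the key wires. Then the
probability that the transported answer wire `emb 0` reads `1` after `(H on the key wires) ++ retarget p emb gs`
relative to `A` is the AVERAGE over `key ∈ {0,1}^κ` of the acceptance probability of `gs` on `x` relative to the slice
`prefixSlice A c̄_key`, `c_key = (assignKey (t.trans p) w key) ∘ p` the prefix content with that key.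
[cite: Zhandry2012, Thm. 3.1 (run the algorithm on h_key for a uniformly random key)]
[cite: BennettBernsteinBrassardVazirani1997, §4 (oracle subroutines)] -/
theorem sum_normSq_hadamards_retarget_eq_avg_acceptProb {n m N P κ : ℕ} (gs : List (QGate cliffordT (n + m)))
    (h0 : 0 < n + m) (p : Fin P ↪ Fin N) (emb : Fin (n + m) ↪ Fin N) (hdisj : ∀ a i, p a ≠ emb i)
    (t : Fin κ ↪ Fin P) (A : Language Bool) (w : QReg N) (x : QReg n) (hwx : w ∘ emb = padInput x m)
    (hw0 : ∀ j, w ((t.trans p) j) = false) :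
    (∑ y ∈ univ.filter (fun y : QReg N => y (emb ⟨0, h0⟩) = true),
        ‖((⟨(List.ofFn (t.trans p)).map hOn ++ retarget p emb hdisj gs⟩ : QCircuit cliffordT N).toMatrix A *ᵥ
          basisState w) y‖ ^ 2) =
      (1 / 2 : ℝ) ^ κ * ∑ key : QReg κ,
        (⟨gs⟩ : QCircuit cliffordT (n + m)).acceptProb
          (prefixSlice A (List.ofFn (assignKey (t.trans p) w key ∘ p))) x := by
  classical
  -- (1) Hadamards on the key wires, then a circuit keeping them classical: average over the keys
  have hbody : KeyDiagonal (t.trans p) ((⟨retarget p emb hdisj gs⟩ : QCircuit cliffordT N).toMatrix A) :=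
    (keyDiagonal_retarget p emb hdisj A gs).of_trans t
  rw [sum_normSq_hadamards_then_keyDiagonal (t.trans p) (retarget p emb hdisj gs) A hbody w hw0]
  congr 1
  refine Finset.sum_congr rfl fun key _ => ?_
  -- (2) on the branch of this key, the re-targeted circuit is the original circuit on the sliced oracle, placed along `emb`
  set c : QReg P := assignKey (t.trans p) w key ∘ p with hc
  rw [toMatrix_retarget_mulVec_eq_placeGate p emb hdisj A c gs (basisState_assignKey_supported p t w key)]
  -- (3) one-register Born rule along `emb`, then the acceptance probability of `gs`
  rw [Finset.sum_filter]
  have hev : ∀ y : QReg N, (y (emb ⟨0, h0⟩) = true) = ((fun u : QReg (n + m) => u ⟨0, h0⟩ = true) (y ∘ emb)) :=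
    fun y => rfl
  simp_rw [hev]
  rw [sum_normSq_placeGate_emb emb _ (assignKey (t.trans p) w key) (fun u : QReg (n + m) => u ⟨0, h0⟩ = true),
    assignKey_comp_emb p emb hdisj t w key, hwx, acceptProb_eq_sum_ite _ _ _ h0]


/-! ### General events read through the transported wires (appended) -/

/-- **The key-average identity for an arbitrary event on the transported register.** Same setting as
`sum_normSq_hadamards_retarget_eq_avg_acceptProb`, with the answer-wire event replaced by any event `T` on the small
register read through `emb` (e.g. "the query register of a given oracle gate spells `σ`", for truncated runs): the
probability of `{y | T (y ∘ emb)}` after `(H on the key wires) ++ retarget p emb gs` on `|w⟩`, relative to `A`, is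
`2^{-κ} Σ_key Pr_T[gs run on |x 0^m⟩ relative to prefixSlice A c̄_key]`, the latter written as the Born sum
`Σ_{u : T u} |U u (x 0^m)|²` (`= probEvent` of `{u | T u}` on the basis input).
[cite: Zhandry2012, Thm. 3.1] [cite: NielsenChuang2010, §2.2.8] -/
theorem sum_normSq_hadamards_retarget_eq_avg_event {n m N P κ : ℕ} (gs : List (QGate cliffordT (n + m)))
    (p : Fin P ↪ Fin N) (emb : Fin (n + m) ↪ Fin N) (hdisj : ∀ a i, p a ≠ emb i)
    (t : Fin κ ↪ Fin P) (A : Language Bool) (w : QReg N) (x : QReg n) (hwx : w ∘ emb = padInput x m)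
    (hw0 : ∀ j, w ((t.trans p) j) = false) (T : QReg (n + m) → Prop) [DecidablePred T] :
    (∑ y ∈ univ.filter (fun y : QReg N => T (y ∘ emb)),
        ‖((⟨(List.ofFn (t.trans p)).map hOn ++ retarget p emb hdisj gs⟩ : QCircuit cliffordT N).toMatrix A *ᵥ
          basisState w) y‖ ^ 2) =
      (1 / 2 : ℝ) ^ κ * ∑ key : QReg κ, ∑ u : QReg (n + m),
        if T u then ‖(⟨gs⟩ : QCircuit cliffordT (n + m)).toMatrix
          (prefixSlice A (List.ofFn (assignKey (t.trans p) w key ∘ p))) u (padInput x m)‖ ^ 2 else 0 := by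
  classical
  have hbody : KeyDiagonal (t.trans p) ((⟨retarget p emb hdisj gs⟩ : QCircuit cliffordT N).toMatrix A) :=
    (keyDiagonal_retarget p emb hdisj A gs).of_trans t
  rw [sum_normSq_hadamards_then_keyDiagonal (t.trans p) (retarget p emb hdisj gs) A hbody w hw0]
  congr 1
  refine Finset.sum_congr rfl fun key _ => ?_
  set c : QReg P := assignKey (t.trans p) w key ∘ p with hc
  rw [toMatrix_retarget_mulVec_eq_placeGate p emb hdisj A c gs (basisState_assignKey_supported p t w key),
    Finset.sum_filter, sum_normSq_placeGate_emb emb _ (assignKey (t.trans p) w key) T,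
    assignKey_comp_emb p emb hdisj t w key, hwx]

/-- The Born sum over an event on the basis input `|x 0^m⟩` is the circuit's `probEvent`. [cite: NielsenChuang2010, §2.2.5] -/
theorem sum_ite_normSq_toMatrix_eq_probEvent {G : QGateSet} {n m : ℕ} (B : Language Bool) (C : QCircuit G (n + m))
    (x : QReg n) (T : QReg (n + m) → Prop) [DecidablePred T] :
    (∑ u : QReg (n + m), if T u then ‖C.toMatrix B u (padInput x m)‖ ^ 2 else 0) =
      C.probEvent B (basisState (padInput x m)) {u | T u} := by
  classical
  unfold QCircuit.probEvent QCircuit.runOn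
  rw [Finset.sum_filter]
  refine Finset.sum_congr rfl fun u _ => ?_
  rw [mulVec_basisState]
  simp only [Set.mem_setOf_eq]

end Literature.Computability.QuantumComplexity

end
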